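import Literature.Analysis.Calculus.BorderedImplicitFunction

/-!
# The bordered implicit FAMILY (Lyapunov–Schmidt reduction with a one-dimensional kernel and an
# external border vector: Chow–Hale 1982, §2.4 and Ch. 6; Vanderbauwhede 1982, Ch. 8;
# Kielhöfer 2012, §I.2)

Analysis/Calculus proof file (Mathlib only; theorems only, no definitions, no named facts).
Companion of `Literature.Analysis.Calculus.BorderedImplicitFunction`: there the bordered system
`(N u + frc (c' − t d), φ (u − u₀)) = (0, 0)` is solved for `(u, t)` as a function of the parameter
`c'` alone, the kernel coordinate `φ (u − u₀)` being frozen at `0` and the border vector being the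
force direction `frc d`.  Here the kernel coordinate is FREE and the border vector `e ∉ range T` is
EXTERNAL: at a zero `u₀` of `u ↦ N u + frc c` whose linearisation `T = DN(u₀)` makes the bordered
operator `(w, t) ↦ (T w − t e, φ w)` bijective `X × ℝ → Y × ℝ` (the bordering lemma
`bordered_bijective`: `ker T ⊆ ℝ·g`, `e ∉ range T`, `φ g ≠ 0`), the implicit function theorem
applied to `Φ ((c', x), (u, t)) := (N u + frc c' − t e, φ (u − u₀) − x)` produces the
two-parameter family `(c', x) ↦ (υ (c', x), σ (c', x))` of solutions of the Lyapunov–Schmidt system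
`N (υ q) + frc q.1 − σ q • e = 0`, `φ (υ q − u₀) = q.2`, together with LOCAL UNIQUENESS on a
product ball and the first-order information carried by `ℓ = Dσ(c, 0)`: when `e ∉ range T`,
`ℓ (0, 1) = 0` (the kernel direction is invisible at first order) and
`ℓ (d, 0) = 0 ↔ frc d ∈ range T` (a parameter direction is visible at first order exactly when its
force leaves the range).  This is the standard Lyapunov–Schmidt reduction at a simply degenerate
point (Chow–Hale 1982, §2.4 "bordered operators" and Ch. 6; Vanderbauwhede 1982, Ch. 8;
Kielhöfer 2012, §I.2), packaged so that the reduced ("bifurcation") function is the scalar `σ`.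

* `bordered_implicit_family` — the statement above, for `N` of class `C¹` at `u₀`.
* `malkin_implicit_family` — the same combined with the bordering lemma `bordered_bijective`
  (compact perturbation of a linear homeomorphism, `ker T ⊆ ℝ·g`, `e ∉ range T`, `φ g ≠ 0`); here
  the first-derivative tests hold unconditionally.

Not here: the group-orbit / Malkin-function analysis that consumes `σ` (summit side), higher
kernel dimension, parameter-dependent `N`, higher-order expansions of `σ`.

## References

* S.-N. Chow, J. K. Hale, *Methods of Bifurcation Theory*, Grundlehren 251, Springer (1982), §2.4,
  Ch. 6. [ChowHale1982]
* A. Vanderbauwhede, *Local Bifurcation and Symmetry*, Research Notes in Mathematics 75, Pitman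
  (1982), Ch. 8. [Vanderbauwhede1982]
* H. Kielhöfer, *Bifurcation Theory. An Introduction with Applications to Partial Differential
  Equations*, 2nd ed., Applied Mathematical Sciences 156, Springer (2012), §I.2 (the
  Lyapunov–Schmidt reduction). [Kielhofer2012]
-/

noncomputable section

open scoped Topology
open Filter Set Function

namespace Literature.Analysis.Calculus

section Family

variable {X Y : Type*} [NormedAddCommGroup X] [NormedSpace ℝ X] [CompleteSpace X]
  [NormedAddCommGroup Y] [NormedSpace ℝ Y] [CompleteSpace Y]
  {P : Type*} [NormedAddCommGroup P] [NormedSpace ℝ P] [CompleteSpace P]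

/-- **The bordered implicit family** (Lyapunov–Schmidt reduction with a one-dimensional kernel;
Chow–Hale 1982 §2.4 and Ch. 6, Vanderbauwhede 1982 Ch. 8, Kielhöfer 2012 §I.2).  Let `N : X → Y` be
`C¹` at `u₀` with derivative `T`, `frc : P → Y` continuous linear, `N u₀ + frc c = 0`, and let the
bordered operator `(w, t) ↦ (T w − t·e, φ w)` be bijective.  Then there are `σ : P × ℝ → ℝ`,
`υ : P × ℝ → X`, `C¹` at `(c, 0)` and continuous on a ball of radius `r` around `(c, 0)`, with
`σ (c, 0) = 0`, `υ (c, 0) = u₀`, solving `N (υ q) + frc q.1 − σ q • e = 0`, `φ (υ q − u₀) = q.2` on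
that ball, UNIQUELY among `(u, t)` with `dist u u₀ < r`, `|t| < r`; and the derivative
`ℓ = Dσ(c, 0)` satisfies, when `e ∉ range T`: `ℓ (0, 1) = 0` and `ℓ (d, 0) = 0 ↔ frc d ∈ range T`.
[folklore] -/
theorem bordered_implicit_family (N : X → Y) (frc : P →L[ℝ] Y) (T : X →L[ℝ] Y) (φ : X →L[ℝ] ℝ)
    (u₀ : X) (c : P) (e : Y) (hN : ContDiffAt ℝ 1 N u₀) (hT : HasFDerivAt N T u₀)
    (h0 : N u₀ + frc c = 0)
    (hD : Function.Bijective fun p : X × ℝ => (T p.1 - p.2 • e, φ p.1)) :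
    ∃ (σ : P × ℝ → ℝ) (υ : P × ℝ → X) (ℓ : P × ℝ →L[ℝ] ℝ) (r : ℝ), 0 < r ∧ σ (c, 0) = 0 ∧
      υ (c, 0) = u₀ ∧ HasFDerivAt σ ℓ (c, 0) ∧ ContDiffAt ℝ 1 σ (c, 0) ∧ ContDiffAt ℝ 1 υ (c, 0) ∧
      ((∀ w : X, T w ≠ e) → ℓ (0, 1) = 0 ∧ ∀ d : P, (ℓ (d, 0) = 0 ↔ ∃ w : X, T w = frc d)) ∧
      ContinuousOn σ (Metric.ball ((c, 0) : P × ℝ) r) ∧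
      ContinuousOn υ (Metric.ball ((c, 0) : P × ℝ) r) ∧
      (∀ q ∈ Metric.ball ((c, 0) : P × ℝ) r,
        N (υ q) + frc q.1 - σ q • e = 0 ∧ φ (υ q - u₀) = q.2) ∧
      ∀ q ∈ Metric.ball ((c, 0) : P × ℝ) r, ∀ (u : X) (t : ℝ), dist u u₀ < r → |t| < r →
        N u + frc q.1 - t • e = 0 → φ (u - u₀) = q.2 → t = σ q ∧ u = υ q := by
  -- the map `Φ ((c', x), (u, t)) = (N u + frc c' − t e, φ (u − u₀) − x)` and its base point
  set Φ : (P × ℝ) × (X × ℝ) → Y × ℝ :=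
    fun v => (N v.2.1 + frc v.1.1 - v.2.2 • e, φ (v.2.1 - u₀) - v.1.2) with hΦ
  set pt : (P × ℝ) × (X × ℝ) := ((c, 0), (u₀, 0)) with hpt
  have hΦpt : Φ pt = 0 := by simp [hΦ, hpt, h0]
  -- projections and the derivative of `Φ` at `pt`
  set πq : (P × ℝ) × (X × ℝ) →L[ℝ] P × ℝ := ContinuousLinearMap.fst ℝ (P × ℝ) (X × ℝ) with hπq
  set πp : (P × ℝ) × (X × ℝ) →L[ℝ] X × ℝ := ContinuousLinearMap.snd ℝ (P × ℝ) (X × ℝ) with hπp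
  set πc : (P × ℝ) × (X × ℝ) →L[ℝ] P := (ContinuousLinearMap.fst ℝ P ℝ).comp πq with hπc
  set πx : (P × ℝ) × (X × ℝ) →L[ℝ] ℝ := (ContinuousLinearMap.snd ℝ P ℝ).comp πq with hπx
  set πu : (P × ℝ) × (X × ℝ) →L[ℝ] X := (ContinuousLinearMap.fst ℝ X ℝ).comp πp with hπu
  set πt : (P × ℝ) × (X × ℝ) →L[ℝ] ℝ := (ContinuousLinearMap.snd ℝ X ℝ).comp πp with hπt
  set Φ' : (P × ℝ) × (X × ℝ) →L[ℝ] Y × ℝ :=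
    (T.comp πu + frc.comp πc - πt.smulRight e).prod (φ.comp πu - πx) with hΦ'
  have hπupt : πu pt = u₀ := rfl
  have e2 : (fun v : (P × ℝ) × (X × ℝ) => frc v.1.1) = ⇑(frc.comp πc) := by
    funext v; simp [hπc, hπq]
  have e2' : (fun v : (P × ℝ) × (X × ℝ) => v.2.2 • e) = ⇑(πt.smulRight e) := by
    funext v; simp [hπt, hπp]
  have e3 : (fun v : (P × ℝ) × (X × ℝ) => φ (v.2.1 - u₀) - v.1.2) =
      fun v => (φ.comp πu - πx) v - φ u₀ := by
    funext v
    simp [hπu, hπp, hπx, hπq]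
    abel
  have hΦd : HasFDerivAt Φ Φ' pt := by
    have h1 : HasFDerivAt (fun v : (P × ℝ) × (X × ℝ) => N v.2.1) (T.comp πu) pt := by
      have hT' : HasFDerivAt N T (πu pt) := by rw [hπupt]; exact hT
      exact hT'.comp pt πu.hasFDerivAt
    have h2 : HasFDerivAt (fun v : (P × ℝ) × (X × ℝ) => frc v.1.1) (frc.comp πc) pt := by
      rw [e2]; exact (frc.comp πc).hasFDerivAt
    have h2' : HasFDerivAt (fun v : (P × ℝ) × (X × ℝ) => v.2.2 • e) (πt.smulRight e) pt := by
      rw [e2']; exact (πt.smulRight e).hasFDerivAt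
    have h3 : HasFDerivAt (fun v : (P × ℝ) × (X × ℝ) => φ (v.2.1 - u₀) - v.1.2)
        (φ.comp πu - πx) pt := by
      rw [e3]; exact (φ.comp πu - πx).hasFDerivAt.sub_const (φ u₀)
    exact ((h1.add h2).sub h2').prodMk h3
  have hΦc : ContDiffAt ℝ 1 Φ pt := by
    have h1 : ContDiffAt ℝ 1 (fun v : (P × ℝ) × (X × ℝ) => N v.2.1) pt := by
      have hN' : ContDiffAt ℝ 1 N (πu pt) := by rw [hπupt]; exact hN
      exact hN'.comp pt πu.contDiff.contDiffAt
    have h2 : ContDiffAt ℝ 1 (fun v : (P × ℝ) × (X × ℝ) => frc v.1.1) pt := by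
      rw [e2]; exact (frc.comp πc).contDiff.contDiffAt
    have h2' : ContDiffAt ℝ 1 (fun v : (P × ℝ) × (X × ℝ) => v.2.2 • e) pt := by
      rw [e2']; exact (πt.smulRight e).contDiff.contDiffAt
    have h3 : ContDiffAt ℝ 1 (fun v : (P × ℝ) × (X × ℝ) => φ (v.2.1 - u₀) - v.1.2) pt := by
      rw [e3]; exact (φ.comp πu - πx).contDiff.contDiffAt.sub contDiffAt_const
    exact ((h1.add h2).sub h2').prodMk h3
  -- the partial derivative in `(u, t)` is the bordered operator, which is invertible
  have hinr : ⇑(Φ' ∘L ContinuousLinearMap.inr ℝ (P × ℝ) (X × ℝ)) =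
      fun p : X × ℝ => (T p.1 - p.2 • e, φ p.1) := by
    funext p
    obtain ⟨w, t⟩ := p
    simp [hΦ', hπu, hπt, hπc, hπx, hπq, hπp, sub_eq_add_neg]
  have if₂ : (fderiv ℝ Φ pt ∘L ContinuousLinearMap.inr ℝ (P × ℝ) (X × ℝ)).IsInvertible := by
    rw [hΦd.fderiv]
    have hb : Bijective (Φ' ∘L ContinuousLinearMap.inr ℝ (P × ℝ) (X × ℝ)) := by
      rw [hinr]; exact hD
    exact ⟨ContinuousLinearEquiv.ofBijective _ (LinearMap.ker_eq_bot.2 hb.1)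
      (LinearMap.range_eq_top.2 hb.2), ContinuousLinearEquiv.coe_ofBijective _ _ _⟩
  -- the implicit function `ψ = (υ, σ)`
  set ψ : P × ℝ → X × ℝ := hΦc.implicitFunction one_ne_zero if₂ with hψ
  have hψc : ψ (c, 0) = (u₀, 0) := hΦc.implicitFunction_apply_self one_ne_zero if₂
  have hev : ∀ᶠ q in 𝓝 ((c, 0) : P × ℝ), Φ (q, ψ q) = Φ pt :=
    hΦc.eventually_apply_implicitFunction one_ne_zero if₂
  have huniq : ∀ᶠ v in 𝓝 pt, Φ v = Φ pt ↔ ψ v.1 = v.2 :=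
    hΦc.eventually_apply_eq_iff_implicitFunction one_ne_zero if₂
  have hψd : ContDiffAt ℝ 1 ψ (c, 0) := hΦc.contDiffAt_implicitFunction one_ne_zero if₂
  have hψfd : HasFDerivAt ψ (fderiv ℝ ψ (c, 0)) (c, 0) :=
    (hψd.differentiableAt (by norm_num)).hasFDerivAt
  set Dψ : P × ℝ →L[ℝ] X × ℝ := fderiv ℝ ψ (c, 0) with hDψ
  set σ : P × ℝ → ℝ := fun q => (ψ q).2 with hσ
  set υ : P × ℝ → X := fun q => (ψ q).1 with hυ
  have hσd : ContDiffAt ℝ 1 σ (c, 0) := hψd.snd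
  have hυd : ContDiffAt ℝ 1 υ (c, 0) := hψd.fst
  set ℓ : P × ℝ →L[ℝ] ℝ := (ContinuousLinearMap.snd ℝ X ℝ).comp Dψ with hℓ
  have hσfd : HasFDerivAt σ ℓ (c, 0) := hψfd.snd
  -- differentiating `Φ (q, ψ q) = Φ pt` at `q = (c, 0)`: the linearised Lyapunov–Schmidt system
  have hkey : ∀ (d : P) (s : ℝ),
      T (Dψ (d, s)).1 + frc d = (Dψ (d, s)).2 • e ∧ φ (Dψ (d, s)).1 = s := by
    have hg1 : HasFDerivAt (fun q : P × ℝ => Φ (q, ψ q))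
        (Φ'.comp ((ContinuousLinearMap.id ℝ (P × ℝ)).prod Dψ)) (c, 0) := by
      have hpair : HasFDerivAt (fun q : P × ℝ => (q, ψ q))
          ((ContinuousLinearMap.id ℝ (P × ℝ)).prod Dψ) (c, 0) :=
        (hasFDerivAt_id (c, 0)).prodMk hψfd
      have hΦd' : HasFDerivAt Φ Φ' ((c, 0), ψ (c, 0)) := by rw [hψc]; exact hΦd
      exact hΦd'.comp (c, 0) hpair
    have hg2 : HasFDerivAt (fun q : P × ℝ => Φ (q, ψ q)) (0 : P × ℝ →L[ℝ] Y × ℝ) (c, 0) :=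
      (hasFDerivAt_const (Φ pt) ((c, 0) : P × ℝ)).congr_of_eventuallyEq hev
    have heq := hg1.unique hg2
    intro d s
    have h := DFunLike.congr_fun heq (d, s)
    simpa [hΦ', hπu, hπt, hπc, hπx, hπq, hπp, Prod.ext_iff, sub_eq_zero] using h
  have hderiv : (∀ w : X, T w ≠ e) →
      ℓ (0, 1) = 0 ∧ ∀ d : P, (ℓ (d, 0) = 0 ↔ ∃ w : X, T w = frc d) := by
    intro he
    have hsm : ∀ (w : X) (t : ℝ), T w = t • e → t = 0 := fun w t h => by
      by_contra ht
      exact he (t⁻¹ • w) (by rw [map_smul, h, smul_smul, inv_mul_cancel₀ ht, one_smul])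
    have hℓv : ∀ v, ℓ v = (Dψ v).2 := fun v => rfl
    refine ⟨?_, fun d => ?_⟩
    · obtain ⟨h1, -⟩ := hkey 0 1
      rw [map_zero, add_zero] at h1
      rw [hℓv]
      exact hsm _ _ h1
    · obtain ⟨h1, -⟩ := hkey d 0
      rw [hℓv]
      constructor
      · intro ht
        rw [ht, zero_smul, add_eq_zero_iff_eq_neg] at h1
        exact ⟨-(Dψ (d, 0)).1, by rw [map_neg, h1, neg_neg]⟩
      · rintro ⟨w, hw⟩
        refine hsm ((Dψ (d, 0)).1 + w) _ ?_
        rw [map_add, hw, h1]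
  -- a ball on which everything holds
  have hψcont : ∀ᶠ q in 𝓝 ((c, 0) : P × ℝ), ContDiffAt ℝ 1 ψ q := hψd.eventually (by simp)
  obtain ⟨r₁, hr₁, hb₁⟩ := Metric.eventually_nhds_iff.1 (hev.and hψcont)
  obtain ⟨r₂, hr₂, hb₂⟩ := Metric.eventually_nhds_iff.1 huniq
  have hm₁ : ∀ q ∈ Metric.ball ((c, 0) : P × ℝ) (min r₁ r₂), dist q (c, 0) < r₁ := fun q hq =>
    lt_of_lt_of_le (Metric.mem_ball.1 hq) (min_le_left _ _)
  have hm₂ : ∀ q ∈ Metric.ball ((c, 0) : P × ℝ) (min r₁ r₂), dist q (c, 0) < r₂ := fun q hq =>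
    lt_of_lt_of_le (Metric.mem_ball.1 hq) (min_le_right _ _)
  refine ⟨σ, υ, ℓ, min r₁ r₂, lt_min hr₁ hr₂, by simp [hσ, hψc], by simp [hυ, hψc], hσfd, hσd, hυd,
    hderiv, fun q hq => ((hb₁ (hm₁ q hq)).2.continuousAt.snd).continuousWithinAt,
    fun q hq => ((hb₁ (hm₁ q hq)).2.continuousAt.fst).continuousWithinAt, fun q hq => ?_,
    fun q hq u t hu ht hNu hφu => ?_⟩
  · have hq' := (hb₁ (hm₁ q hq)).1
    rw [hΦpt] at hq'
    simp only [hΦ, Prod.mk_eq_zero] at hq'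
    exact ⟨hq'.1, sub_eq_zero.1 hq'.2⟩
  · have hv : dist ((q, (u, t)) : (P × ℝ) × (X × ℝ)) pt < r₂ := by
      rw [hpt, Prod.dist_eq, max_lt_iff]
      refine ⟨hm₂ q hq, ?_⟩
      rw [Prod.dist_eq, max_lt_iff]
      refine ⟨lt_of_lt_of_le hu (min_le_right _ _), ?_⟩
      rw [Real.dist_0_eq_abs]
      exact lt_of_lt_of_le ht (min_le_right _ _)
    have hΦv : Φ (q, (u, t)) = Φ pt := by
      rw [hΦpt]
      show (N u + frc q.1 - t • e, φ (u - u₀) - q.2) = 0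
      rw [hNu, hφu, sub_self, Prod.mk_zero_zero]
    have hψq : ψ q = (u, t) := (hb₂ hv).1 hΦv
    exact ⟨show t = (ψ q).2 by rw [hψq], show u = (ψ q).1 by rw [hψq]⟩

/-- **The Malkin implicit family (abstract; Vanderbauwhede 1982 Ch. 8, Chow–Hale 1982 §2.4).**
Compact perturbation `T` of a linear homeomorphism `J` with `ker T ⊆ ℝ·g`, `e ∉ range T` and a
functional `φ` with `φ g ≠ 0` ⇒ the two-parameter bordered family `(σ, υ, ℓ, r)` of
`bordered_implicit_family`, with the first-derivative tests `ℓ (0, 1) = 0`,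
`ℓ (d, 0) = 0 ↔ frc d ∈ range T` holding outright. [folklore] -/
theorem malkin_implicit_family (N : X → Y) (frc : P →L[ℝ] Y) (T : X →L[ℝ] Y) (J : X ≃L[ℝ] Y)
    (φ : X →L[ℝ] ℝ) (u₀ g : X) (c : P) (e : Y) (hN : ContDiffAt ℝ 1 N u₀) (hT : HasFDerivAt N T u₀)
    (h0 : N u₀ + frc c = 0) (hK : IsCompactOperator (T - (J : X →L[ℝ] Y) : X →L[ℝ] Y))
    (hker : ∀ x, T x = 0 → ∃ z : ℝ, x = z • g) (hrange : ∀ x, T x ≠ e) (hφ : φ g ≠ 0) :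
    ∃ (σ : P × ℝ → ℝ) (υ : P × ℝ → X) (ℓ : P × ℝ →L[ℝ] ℝ) (r : ℝ), 0 < r ∧ σ (c, 0) = 0 ∧
      υ (c, 0) = u₀ ∧ HasFDerivAt σ ℓ (c, 0) ∧ ContDiffAt ℝ 1 σ (c, 0) ∧ ContDiffAt ℝ 1 υ (c, 0) ∧
      ℓ (0, 1) = 0 ∧ (∀ d : P, (ℓ (d, 0) = 0 ↔ ∃ w : X, T w = frc d)) ∧
      ContinuousOn σ (Metric.ball ((c, 0) : P × ℝ) r) ∧
      ContinuousOn υ (Metric.ball ((c, 0) : P × ℝ) r) ∧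
      (∀ q ∈ Metric.ball ((c, 0) : P × ℝ) r,
        N (υ q) + frc q.1 - σ q • e = 0 ∧ φ (υ q - u₀) = q.2) ∧
      ∀ q ∈ Metric.ball ((c, 0) : P × ℝ) r, ∀ (u : X) (t : ℝ), dist u u₀ < r → |t| < r →
        N u + frc q.1 - t • e = 0 → φ (u - u₀) = q.2 → t = σ q ∧ u = υ q := by
  obtain ⟨σ, υ, ℓ, r, hr, hσ0, hυ0, hσℓ, hσd, hυd, hder, hσc, hυc, hsol, huniq⟩ :=
    bordered_implicit_family N frc T φ u₀ c e hN hT h0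
      (bordered_bijective T J hK g e φ hker hrange hφ)
  exact ⟨σ, υ, ℓ, r, hr, hσ0, hυ0, hσℓ, hσd, hυd, (hder hrange).1, (hder hrange).2, hσc, hυc, hsol,
    huniq⟩

end Family

end Literature.Analysis.Calculus

end
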